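import Literature.Topology.FourManifolds.PresentationHandlebodyFive
import Literature.Topology.FourManifolds.HandleAttachingMapsShrink
import Literature.AlgebraicTopology.Homotopy.StrongDeformationRetractTransport
import Literature.AlgebraicTopology.FundamentalGroup.VanKampenDeformation
import Mathlib.Analysis.Convex.Contractible
import Mathlib.Analysis.Normed.Module.Connected
import HarnessLib

/-!
# The tube `T ⊆ D⁵` of a 5-dimensional 2-handle: deformation retractions, connectivity, and the
# simple connectivity of the handle piece `D⁵ ∖ S`

Topic `Literature/Topology/FourManifolds`; point-set/homotopy facts about Kosinski's model of a
5-dimensional 2-handle (`HandleAttachingMaps.lean`: the tube `T = {x ∈ D⁵ | x_λ ≠ 0}`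
(`handleTube 4 2`), the attaching circle `S = {|x_λ| = 1, x_μ = 0}` (`attachingSphereSet 4 2`)
and the handle piece `D⁵ ∖ S` (`beltPiece 4 2`); Kosinski, *Differential Manifolds* (1993),
VI §6), needed for the van Kampen computation of the fundamental group of a manifold with
2-handles attached (Kosinski VII §7; the tree's fact seat
`provefact-Literature.Topology.FourManifolds.IsPres-00f4a95322`).  Everything here is PROVED; no
definitions, no named facts.

* `exists_handleTube_homotopy` — for `0 < c ≤ 1`, **the radial deformation
  `H_s(x_λ, x_μ) = (((1 - s) + s c/|x_λ|) x_λ, (1 - s) x_μ)` of `T`** onto the parallel circle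
  `K_c = {|x_λ| = c, x_μ = 0}` (a block rescaling, `blockScale`; it stays in `D⁵` by convexity
  of the disc `{(|x_λ|, |x_μ|)}` and keeps `x_λ ≠ 0`), with its bookkeeping;
* `isStrongDeformationRetractOf_parallel_univ`, `isStrongDeformationRetractOf_parallel_of_lt` —
  `K_c` is a strong deformation retract of `T` (`0 < c ≤ 1`) and of `T ∖ S` (`0 < c < 1`);
  `isStrongDeformationRetractOf_attachingSphere` — **the attaching circle `S = K_1` is a strong
  deformation retract of `T`** (Kosinski VI §6: `T` is a tubular neighbourhood of `S`);
* `isPathConnected_parallel` (`K_c` is a circle), `isPathConnected_handleTube_univ`,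
  `isPathConnected_handleTube_lamSq_ne_one` (`T`, `T ∖ S` are path connected),
  `isPathConnected_beltPiece_lamSq_ne_zero` (`T ∖ S` read in the handle piece);
* `simplyConnectedSpace_beltPiece`, `isSimplyConnected_beltPiece_univ` — **the handle piece
  `D⁵ ∖ S` is simply connected** (it is star-shaped about the centre of `D⁵`).

## References

* A. A. Kosinski, *Differential Manifolds*, Academic Press (1993), VI §6 (the model `T`, `S`,
  `Dᵐ ∖ S` of a handle), VII §7. [Kosinski1993]
* A. Hatcher, *Algebraic Topology* (2002), Ch. 0, pp. 2–4 (deformation retractions; star-shaped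
  sets are contractible). [HatcherAT2002]
-/

open scoped Manifold ContDiff Topology
open Set Function Metric

noncomputable section

namespace Literature.Topology.FourManifolds

open Literature.AlgebraicTopology.Homotopy HandleShrink

/-! ### §1 Block rescalings: the scalar case and continuity -/

section BlockScale

variable {m : ℕ}

/-- A block rescaling with equal coefficients is a homothety. [folklore] -/
theorem blockScale_self_eq_smul (k : ℕ) (c : ℝ) (u : EuclideanSpace ℝ (Fin m)) :
    blockScale k c c u = c • u := by
  ext i
  simp only [blockScale_apply, PiLp.smul_apply, smul_eq_mul]
  split_ifs <;> rfl

/-- `|c x|_λ² = c² |x_λ|²`. [folklore] -/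
theorem lamSq_smul (k : ℕ) (c : ℝ) (u : EuclideanSpace ℝ (Fin m)) :
    lamSq k (c • u) = c ^ 2 * lamSq k u := by
  rw [← blockScale_self_eq_smul, lamSq_blockScale]

/-- `‖(c x_λ, d x_μ)‖² = c² |x_λ|² + d² |x_μ|²`. [folklore] -/
theorem norm_blockScale_sq (k : ℕ) (c d : ℝ) (u : EuclideanSpace ℝ (Fin m)) :
    ‖blockScale k c d u‖ ^ 2 = c ^ 2 * lamSq k u + d ^ 2 * muSq k u := by
  rw [← lamSq_add_muSq k, lamSq_blockScale, muSq_blockScale]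

/-- Block rescalings are jointly continuous in the coefficients and the vector. [folklore] -/
theorem continuous_blockScale_uncurry (k : ℕ) :
    Continuous fun p : ℝ × ℝ × EuclideanSpace ℝ (Fin m) => blockScale k p.1 p.2.1 p.2.2 := by
  unfold blockScale
  refine (PiLp.continuous_toLp 2 _).comp ?_
  refine continuous_pi fun i => ?_
  by_cases hi : (i : ℕ) < k
  · simp only [hi, if_true]
    fun_prop
  · simp only [hi, if_false]
    fun_prop

/-- `|x_μ|² = 0` forces `x_μ = 0` coordinatewise. [folklore] -/
theorem apply_eq_zero_of_muSq_eq_zero {k : ℕ} {u : EuclideanSpace ℝ (Fin m)} (h : muSq k u = 0)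
    {i : Fin m} (hi : k ≤ (i : ℕ)) : u i = 0 := by
  unfold muSq at h
  have h' := (Finset.sum_eq_zero_iff_of_nonneg (fun j _ => sq_nonneg (u j))).1 h i
    (by simp [hi])
  exact pow_eq_zero_iff two_ne_zero |>.1 h'

end BlockScale

/-! ### §2 Two elementary inequalities -/

section Ineq

/-- Convexity of the disc `{(r, q) | r² + q ≤ 1}` in the form used by the radial deformation:
`((1 - s) r + s c)² + (1 - s)² q ≤ 1`. [folklore] -/
theorem tube_norm_bound {s c r q : ℝ} (hs0 : 0 ≤ s) (hs1 : s ≤ 1) (hc0 : 0 ≤ c) (hc1 : c ≤ 1)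
    (hr0 : 0 ≤ r) (hq0 : 0 ≤ q) (hrq : r ^ 2 + q ≤ 1) :
    ((1 - s) * r + s * c) ^ 2 + (1 - s) ^ 2 * q ≤ 1 := by
  have hr1 : r ≤ 1 := by nlinarith
  have hrc : r * c ≤ 1 := by nlinarith
  have hcc : c ^ 2 ≤ 1 := by nlinarith
  have h1s : 0 ≤ 1 - s := by linarith
  calc ((1 - s) * r + s * c) ^ 2 + (1 - s) ^ 2 * q
        = (1 - s) ^ 2 * (r ^ 2 + q) + 2 * ((1 - s) * s) * (r * c) + s ^ 2 * c ^ 2 := by ring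
    _ ≤ (1 - s) ^ 2 * 1 + 2 * ((1 - s) * s) * 1 + s ^ 2 * 1 := by
        gcongr
    _ = 1 := by ring

/-- A convex combination of two positive numbers is positive. [folklore] -/
theorem tube_coeff_pos {s c r : ℝ} (hs0 : 0 ≤ s) (hs1 : s ≤ 1) (hc : 0 < c) (hr : 0 < r) :
    0 < (1 - s) * r + s * c := by
  have hm : 0 < min r c := lt_min hr hc
  have h1 : (1 - s) * min r c ≤ (1 - s) * r :=
    mul_le_mul_of_nonneg_left (min_le_left r c) (by linarith)
  have h2 : s * min r c ≤ s * c := mul_le_mul_of_nonneg_left (min_le_right r c) hs0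
  nlinarith

/-- A convex combination of two numbers `< 1` is `< 1`. [folklore] -/
theorem tube_coeff_lt_one {s c r : ℝ} (hs0 : 0 ≤ s) (hs1 : s ≤ 1) (hc : c < 1) (hr : r < 1) :
    (1 - s) * r + s * c < 1 := by
  have hm : max r c < 1 := max_lt hr hc
  have h1 : (1 - s) * r ≤ (1 - s) * max r c :=
    mul_le_mul_of_nonneg_left (le_max_left r c) (by linarith)
  have h2 : s * c ≤ s * max r c := mul_le_mul_of_nonneg_left (le_max_right r c) hs0
  nlinarith

end Ineq

/-! ### §3 The radial deformation of the tube onto a parallel circle -/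

section Tube

/-- `|x_λ|² > 0` on the tube. [folklore] -/
theorem lamSq_pos_handleTube₅ (y : ↥(handleTube 4 2)) : 0 < lamSq 2 y.1.1 :=
  lt_of_le_of_ne (lamSq_nonneg 2 _) (Ne.symm y.2)

/-- `|x_λ|² ≤ 1` on the tube. [folklore] -/
theorem lamSq_le_one_handleTube₅ (y : ↥(handleTube 4 2)) : lamSq 2 y.1.1 ≤ 1 :=
  lamSq_le_one (mem_closedBall_zero_iff.1 y.1.2)

/-- `|x_λ| > 0` on the tube. [folklore] -/
theorem sqrt_lamSq_pos_handleTube (y : ↥(handleTube 4 2)) : 0 < Real.sqrt (lamSq 2 y.1.1) :=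
  Real.sqrt_pos.2 (lamSq_pos_handleTube₅ y)

/-- **The radial deformation of the tube `T ⊆ D⁵` onto the parallel circle
`K_c = {|x_λ| = c, x_μ = 0}`** (`0 < c ≤ 1`): the homotopy
`H_s(x_λ, x_μ) = (((1 - s) + s c/|x_λ|) x_λ, (1 - s) x_μ)` (time clamped to `[0, 1]`) maps `T`
into `T` (`|·_λ|` of the image is the convex combination `(1 - s)|x_λ| + s c > 0`, and the image
stays in `D⁵` because `((1 - s)|x_λ| + s c, (1 - s)|x_μ|)` is a convex combination of the points
`(|x_λ|, |x_μ|)`, `(c, 0)` of the unit disc), is the identity at `s = 0`, ends in `K_c`, fixes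
`K_c` pointwise, and does not create points of the attaching circle `S = {|x_λ| = 1}` when
`c < 1`.  Kosinski's tube `T` is a tubular neighbourhood of `S` with projection `x ↦ x_λ/|x_λ|`
(VI §6); this is its fibrewise contraction, stopped at the circle `K_c`.
[cite: Kosinski1993, VI §6] -/
theorem exists_handleTube_homotopy {c : ℝ} (hc : 0 < c) (hc1 : c ≤ 1) :
    ∃ H : ℝ → ↥(handleTube 4 2) → ↥(handleTube 4 2),
      Continuous (fun p : ℝ × ↥(handleTube 4 2) => H p.1 p.2) ∧
      (∀ y, H 0 y = y) ∧
      (∀ y, lamSq 2 (H 1 y).1.1 = c ^ 2 ∧ muSq 2 (H 1 y).1.1 = 0) ∧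
      (∀ t y, lamSq 2 y.1.1 = c ^ 2 → muSq 2 y.1.1 = 0 → H t y = y) ∧
      (∀ t y, lamSq 2 y.1.1 < 1 → c < 1 → lamSq 2 (H t y).1.1 < 1) := by
  -- the clamped time
  set σ : ℝ → ℝ := fun t => max 0 (min t 1) with hσ
  have hσ0 : ∀ t, 0 ≤ σ t := fun t => le_max_left _ _
  have hσ1 : ∀ t, σ t ≤ 1 := fun t => max_le zero_le_one (min_le_right _ _)
  have hσc : Continuous σ := continuous_const.max (continuous_id.min continuous_const)
  have hσzero : σ 0 = 0 := by simp [hσ]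
  have hσone : σ 1 = 1 := by simp [hσ]
  -- the deformation on vectors
  set G : ℝ → EuclideanSpace ℝ (Fin 5) → EuclideanSpace ℝ (Fin 5) := fun t x =>
    blockScale 2 ((1 - σ t) + σ t * c / Real.sqrt (lamSq 2 x)) (1 - σ t) x with hG
  -- bookkeeping on the tube
  have hlam : ∀ t (y : ↥(handleTube 4 2)), lamSq 2 (G t y.1.1) =
      ((1 - σ t) * Real.sqrt (lamSq 2 y.1.1) + σ t * c) ^ 2 := by
    intro t y
    have hr := sqrt_lamSq_pos_handleTube y
    have hr2 : Real.sqrt (lamSq 2 y.1.1) ^ 2 = lamSq 2 y.1.1 :=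
      Real.sq_sqrt (lamSq_pos_handleTube₅ y).le
    show lamSq 2 (blockScale 2 ((1 - σ t) + σ t * c / Real.sqrt (lamSq 2 y.1.1)) (1 - σ t) y.1.1) = _
    rw [lamSq_blockScale]
    set q := Real.sqrt (lamSq 2 y.1.1) with hq
    rw [← hr2]
    field_simp
  have hmu : ∀ t (y : ↥(handleTube 4 2)), muSq 2 (G t y.1.1) = (1 - σ t) ^ 2 * muSq 2 y.1.1 :=
    fun t y => by
      show muSq 2 (blockScale 2 ((1 - σ t) + σ t * c / Real.sqrt (lamSq 2 y.1.1)) (1 - σ t) y.1.1) = _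
      rw [muSq_blockScale]
  have hpos : ∀ t (y : ↥(handleTube 4 2)), 0 < (1 - σ t) * Real.sqrt (lamSq 2 y.1.1) + σ t * c :=
    fun t y => tube_coeff_pos (hσ0 t) (hσ1 t) hc (sqrt_lamSq_pos_handleTube y)
  have hlam_ne : ∀ t (y : ↥(handleTube 4 2)), lamSq 2 (G t y.1.1) ≠ 0 := fun t y => by
    rw [hlam]; exact (pow_pos (hpos t y) 2).ne'
  have hnorm : ∀ t (y : ↥(handleTube 4 2)), ‖G t y.1.1‖ ≤ 1 := by
    intro t y
    have hr := sqrt_lamSq_pos_handleTube y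
    have hr2 : Real.sqrt (lamSq 2 y.1.1) ^ 2 = lamSq 2 y.1.1 :=
      Real.sq_sqrt (lamSq_pos_handleTube₅ y).le
    have hy1 : ‖y.1.1‖ ≤ 1 := mem_closedBall_zero_iff.1 y.1.2
    have hsum := lamSq_add_muSq 2 y.1.1
    have hsq : ‖G t y.1.1‖ ^ 2 ≤ 1 := by
      rw [← lamSq_add_muSq 2, hlam, hmu]
      refine tube_norm_bound (hσ0 t) (hσ1 t) hc.le hc1 hr.le (muSq_nonneg 2 _) ?_
      rw [hr2, hsum]
      nlinarith [norm_nonneg y.1.1]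
    nlinarith [norm_nonneg (G t y.1.1)]
  -- the deformation of the tube
  refine ⟨fun t y => ⟨⟨G t y.1.1, mem_closedBall_zero_iff.2 (hnorm t y)⟩, hlam_ne t y⟩,
    ?_, fun y => ?_, fun y => ?_, fun t y hl hm => ?_, fun t y hy hc' => ?_⟩
  · -- continuity
    refine Continuous.subtype_mk (Continuous.subtype_mk ?_ _) _
    have hvec : Continuous fun p : ℝ × ↥(handleTube 4 2) => (p.2.1.1 : EuclideanSpace ℝ (Fin 5)) :=
      continuous_subtype_val.comp (continuous_subtype_val.comp continuous_snd)
    have hl : Continuous fun p : ℝ × ↥(handleTube 4 2) => lamSq 2 p.2.1.1 :=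
      (continuous_lamSq 2).comp hvec
    have hsq : Continuous fun p : ℝ × ↥(handleTube 4 2) => Real.sqrt (lamSq 2 p.2.1.1) :=
      Real.continuous_sqrt.comp hl
    have hsq0 : ∀ p : ℝ × ↥(handleTube 4 2), Real.sqrt (lamSq 2 p.2.1.1) ≠ 0 := fun p =>
      (sqrt_lamSq_pos_handleTube p.2).ne'
    have hcoef : Continuous fun p : ℝ × ↥(handleTube 4 2) =>
        (1 - σ p.1) + σ p.1 * c / Real.sqrt (lamSq 2 p.2.1.1) :=
      (continuous_const.sub (hσc.comp continuous_fst)).add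
        (((hσc.comp continuous_fst).mul continuous_const).div hsq hsq0)
    have hcoef' : Continuous fun p : ℝ × ↥(handleTube 4 2) => 1 - σ p.1 :=
      continuous_const.sub (hσc.comp continuous_fst)
    exact (continuous_blockScale_uncurry 2).comp (hcoef.prodMk (hcoef'.prodMk hvec))
  · -- `s = 0`
    apply Subtype.ext; apply Subtype.ext
    show blockScale 2 ((1 - σ 0) + σ 0 * c / Real.sqrt (lamSq 2 y.1.1)) (1 - σ 0) y.1.1 = y.1.1
    rw [hσzero, sub_zero, zero_mul, zero_div, add_zero]
    exact blockScale_one_one 2 _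
  · -- `s = 1`
    constructor
    · show lamSq 2 (G 1 y.1.1) = c ^ 2
      rw [hlam, hσone]; ring
    · show muSq 2 (G 1 y.1.1) = 0
      rw [hmu, hσone]; ring
  · -- `K_c` is fixed
    apply Subtype.ext; apply Subtype.ext
    have hr : Real.sqrt (lamSq 2 y.1.1) = c := by
      rw [hl, Real.sqrt_sq hc.le]
    show blockScale 2 ((1 - σ t) + σ t * c / Real.sqrt (lamSq 2 y.1.1)) (1 - σ t) y.1.1 = y.1.1
    rw [hr, mul_div_assoc, div_self hc.ne', mul_one, sub_add_cancel]
    ext i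
    rw [blockScale_apply]
    split_ifs with hi
    · ring
    · rw [apply_eq_zero_of_muSq_eq_zero hm (not_lt.1 hi)]; ring
  · -- no new points of `S`
    show lamSq 2 (G t y.1.1) < 1
    rw [hlam]
    have hr1 : Real.sqrt (lamSq 2 y.1.1) < 1 := by
      have h1 := Real.sqrt_lt_sqrt (lamSq_nonneg 2 _) hy
      rwa [Real.sqrt_one] at h1
    have h := tube_coeff_lt_one (hσ0 t) (hσ1 t) hc' hr1
    have h0 := hpos t y
    nlinarith

/-- **The parallel circle `K_c = {|x_λ| = c, x_μ = 0}` is a strong deformation retract of the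
tube `T`** (`0 < c ≤ 1`). [cite: Kosinski1993, VI §6] -/
theorem isStrongDeformationRetractOf_parallel_univ {c : ℝ} (hc : 0 < c) (hc1 : c ≤ 1) :
    IsStrongDeformationRetractOf
      {y : ↥(handleTube 4 2) | lamSq 2 y.1.1 = c ^ 2 ∧ muSq 2 y.1.1 = 0} univ := by
  obtain ⟨H, hcont, h0, h1, hfix, -⟩ := exists_handleTube_homotopy hc hc1
  exact IsStrongDeformationRetractOf.of_continuousOn H hcont.continuousOn
    (fun t _ => mapsTo_univ _ _) (fun y _ => h0 y) (fun y _ => h1 y)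
    (fun t _ y _ hy => hfix t y hy.1 hy.2)

/-- **`K_c` is a strong deformation retract of the punctured tube `T ∖ S`** (`0 < c < 1`; the
same deformation, which does not create points of `S = {|x_λ| = 1}`). [cite: Kosinski1993, VI §6] -/
theorem isStrongDeformationRetractOf_parallel_of_lt {c : ℝ} (hc : 0 < c) (hc1 : c < 1) :
    IsStrongDeformationRetractOf
      {y : ↥(handleTube 4 2) | lamSq 2 y.1.1 = c ^ 2 ∧ muSq 2 y.1.1 = 0}
      {y : ↥(handleTube 4 2) | lamSq 2 y.1.1 ≠ 1} := by
  obtain ⟨H, hcont, h0, h1, hfix, hlt⟩ := exists_handleTube_homotopy hc hc1.le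
  refine IsStrongDeformationRetractOf.of_continuousOn H hcont.continuousOn
    (fun t _ y hy => ?_) (fun y _ => h0 y) (fun y _ => h1 y) (fun t _ y _ hy => hfix t y hy.1 hy.2)
  have hy' : lamSq 2 y.1.1 < 1 := lt_of_le_of_ne (lamSq_le_one_handleTube₅ y) hy
  exact (hlt t y hy' hc1).ne

/-- **The attaching circle `S = {|x_λ| = 1}` is a strong deformation retract of the tube `T`**
(`T` is a tubular neighbourhood of `S`, Kosinski VI §6; the case `c = 1`). [cite: Kosinski1993, VI §6] -/
theorem isStrongDeformationRetractOf_attachingSphere :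
    IsStrongDeformationRetractOf
      {y : ↥(handleTube 4 2) | y.1 ∈ attachingSphereSet 4 2} (univ : Set ↥(handleTube 4 2)) := by
  refine (isStrongDeformationRetractOf_parallel_univ one_pos le_rfl).congr_right ?_ ?_
  · rintro y ⟨⟨hy, -⟩, -⟩
    show lamSq 2 y.1.1 = 1
    rw [hy, one_pow]
  · rintro y ⟨hy, -⟩
    have hy' : lamSq 2 y.1.1 = 1 := hy
    exact ⟨by rw [hy', one_pow], (muSq_eq_zero_of_lamSq_eq_one (mem_closedBall_zero_iff.1 y.1.2) hy').1⟩

/-! ### §4 Connectivity -/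

/-- The parallel circle `K_c` is the image of the circle `θ ↦ (c θ, 0)`, hence path connected.
[folklore] -/
theorem isPathConnected_parallel {c : ℝ} (hc : 0 < c) (hc1 : c ≤ 1) :
    IsPathConnected {y : ↥(handleTube 4 2) | lamSq 2 y.1.1 = c ^ 2 ∧ muSq 2 y.1.1 = 0} := by
  -- the circle map
  have hmem₁ : ∀ θ : sphere (0 : EuclideanSpace ℝ (Fin 2)) 1,
      c • corePt₅ θ ∈ closedBall (0 : EuclideanSpace ℝ (Fin 5)) 1 := fun θ => by
    rw [mem_closedBall_zero_iff, norm_smul, norm_corePt₅, mul_one, Real.norm_eq_abs, abs_of_pos hc]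
    exact hc1
  have hlam₁ : ∀ θ : sphere (0 : EuclideanSpace ℝ (Fin 2)) 1, lamSq 2 (c • corePt₅ θ) = c ^ 2 :=
    fun θ => by rw [lamSq_smul, lamSq_corePt₅, mul_one]
  have hmem₂ : ∀ θ : sphere (0 : EuclideanSpace ℝ (Fin 2)) 1,
      (⟨c • corePt₅ θ, hmem₁ θ⟩ : closedBall (0 : EuclideanSpace ℝ (Fin 5)) 1) ∈ handleTube 4 2 :=
    fun θ => by
      rw [mem_handleTube]
      show lamSq 2 (c • corePt₅ θ) ≠ 0
      rw [hlam₁]; positivity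
  set γ : sphere (0 : EuclideanSpace ℝ (Fin 2)) 1 → ↥(handleTube 4 2) := fun θ =>
    ⟨⟨c • corePt₅ θ, hmem₁ θ⟩, hmem₂ θ⟩ with hγ
  have hγc : Continuous γ := ((continuous_corePt₅.const_smul c).subtype_mk _).subtype_mk _
  have hrange : range γ = {y : ↥(handleTube 4 2) | lamSq 2 y.1.1 = c ^ 2 ∧ muSq 2 y.1.1 = 0} := by
    ext y
    constructor
    · rintro ⟨θ, rfl⟩
      refine ⟨hlam₁ θ, ?_⟩
      show muSq 2 (c • corePt₅ θ) = 0
      rw [← blockScale_self_eq_smul, muSq_blockScale, muSq_corePt₅, mul_zero]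
    · rintro ⟨hl, hm⟩
      set u : EuclideanSpace ℝ (Fin 5) := y.1.1 with hu
      have h2 : u 2 = 0 := apply_eq_zero_of_muSq_eq_zero hm (i := 2) (by norm_num)
      have h3 : u 3 = 0 := apply_eq_zero_of_muSq_eq_zero hm (i := 3) (by norm_num)
      have h4 : u 4 = 0 := apply_eq_zero_of_muSq_eq_zero hm (i := 4) (by norm_num)
      rw [lamSq_two_fin_five] at hl
      let v : EuclideanSpace ℝ (Fin 2) := WithLp.toLp 2 ![u 0 / c, u 1 / c]
      have hv : ‖v‖ = 1 := by
        have : ‖v‖ ^ 2 = 1 := by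
          rw [EuclideanSpace.norm_sq_eq, Fin.sum_univ_two, Real.norm_eq_abs, Real.norm_eq_abs,
            sq_abs, sq_abs]
          simp only [v]
          rw [Matrix.cons_val_zero, Matrix.cons_val_one, Matrix.cons_val_zero, div_pow, div_pow,
            ← add_div, hl, div_self (pow_pos hc 2).ne']
        nlinarith [norm_nonneg v]
      refine ⟨⟨v, mem_sphere_zero_iff_norm.2 hv⟩, ?_⟩
      apply Subtype.ext; apply Subtype.ext
      show c • corePt₅ _ = u
      ext i
      fin_cases i
      · show c * (u 0 / c) = u 0
        field_simp
      · show c * (u 1 / c) = u 1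
        field_simp
      · show c * 0 = u 2
        rw [h2, mul_zero]
      · show c * 0 = u 3
        rw [h3, mul_zero]
      · show c * 0 = u 4
        rw [h4, mul_zero]
  rw [← hrange]
  have hrank : 1 < Module.rank ℝ (EuclideanSpace ℝ (Fin 2)) := by
    rw [← Module.finrank_eq_rank, finrank_euclideanSpace_fin]
    norm_num
  haveI : PathConnectedSpace (sphere (0 : EuclideanSpace ℝ (Fin 2)) 1) :=
    isPathConnected_iff_pathConnectedSpace.1 (isPathConnected_sphere hrank 0 zero_le_one)
  exact isPathConnected_range hγc

/-- **The tube `T` is path connected.** [cite: Kosinski1993, VI §6] -/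
theorem isPathConnected_handleTube_univ : IsPathConnected (univ : Set ↥(handleTube 4 2)) := by
  have h := isStrongDeformationRetractOf_parallel_univ (c := 2⁻¹) (by norm_num) (by norm_num)
  refine h.isPathConnected ?_
  rw [inter_univ]
  exact isPathConnected_parallel (by norm_num) (by norm_num)

/-- The tube `T` is a path-connected space. [cite: Kosinski1993, VI §6] -/
theorem pathConnectedSpace_handleTube : PathConnectedSpace ↥(handleTube 4 2) :=
  pathConnectedSpace_iff_univ.2 isPathConnected_handleTube_univ

/-- **The punctured tube `T ∖ S` is path connected.** [cite: Kosinski1993, VI §6] -/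
theorem isPathConnected_handleTube_lamSq_ne_one :
    IsPathConnected {y : ↥(handleTube 4 2) | lamSq 2 y.1.1 ≠ 1} := by
  have h := isStrongDeformationRetractOf_parallel_of_lt (c := 2⁻¹) (by norm_num) (by norm_num)
  refine h.isPathConnected ?_
  have hsub : {y : ↥(handleTube 4 2) | lamSq 2 y.1.1 = (2⁻¹ : ℝ) ^ 2 ∧ muSq 2 y.1.1 = 0} ⊆
      {y : ↥(handleTube 4 2) | lamSq 2 y.1.1 ≠ 1} := by
    rintro y ⟨hy, -⟩
    show lamSq 2 y.1.1 ≠ 1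
    rw [hy]; norm_num
  rw [inter_eq_left.2 hsub]
  exact isPathConnected_parallel (by norm_num) (by norm_num)

/-- The punctured tube read in `D⁵`: `{x ∈ D⁵ | |x_λ|² ≠ 0, 1}` is path connected. [folklore] -/
theorem isPathConnected_closedBall_lamSq_ne :
    IsPathConnected {u : closedBall (0 : EuclideanSpace ℝ (Fin 5)) 1 |
      lamSq 2 u.1 ≠ 0 ∧ lamSq 2 u.1 ≠ 1} := by
  have h := isPathConnected_handleTube_lamSq_ne_one.image (f := (Subtype.val : ↥(handleTube 4 2) → _))
    continuous_subtype_val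
  have e : Subtype.val '' {y : ↥(handleTube 4 2) | lamSq 2 y.1.1 ≠ 1} =
      {u : closedBall (0 : EuclideanSpace ℝ (Fin 5)) 1 | lamSq 2 u.1 ≠ 0 ∧ lamSq 2 u.1 ≠ 1} := by
    ext u
    constructor
    · rintro ⟨y, hy, rfl⟩
      exact ⟨y.2, hy⟩
    · rintro ⟨h0, h1⟩
      exact ⟨⟨u, h0⟩, h1, rfl⟩
  rwa [e] at h

/-- **The punctured tube read in the handle piece `D⁵ ∖ S`: `{x | x_λ ≠ 0}` is path connected**
(this is the region along which the handle piece is glued to the manifold).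
[cite: Kosinski1993, VI §6] -/
theorem isPathConnected_beltPiece_lamSq_ne_zero :
    IsPathConnected {b : ↥(beltPiece 4 2) | lamSq 2 b.1.1 ≠ 0} := by
  have h := isPathConnected_closedBall_lamSq_ne.preimage_coe
    (U := ((beltPiece 4 2 : TopologicalSpace.Opens (closedBall (0 : EuclideanSpace ℝ (Fin 5)) 1)) :
      Set (closedBall (0 : EuclideanSpace ℝ (Fin 5)) 1))) (fun u hu => hu.2)
  have e : {b : ↥(beltPiece 4 2) | lamSq 2 b.1.1 ≠ 0} =
      ((↑) ⁻¹' {u : closedBall (0 : EuclideanSpace ℝ (Fin 5)) 1 | lamSq 2 u.1 ≠ 0 ∧ lamSq 2 u.1 ≠ 1} :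
        Set ↥(beltPiece 4 2)) := by
    ext b
    simp only [mem_setOf_eq, mem_preimage]
    exact ⟨fun hb => ⟨hb, b.2⟩, fun hb => hb.1⟩
  rw [e]
  exact h

/-! ### §5 The handle piece `D⁵ ∖ S` is simply connected -/

/-- The handle piece `D⁵ ∖ S`, read in `ℝ⁵`, is star-shaped about the centre: for `x ∈ D⁵ ∖ S`
and `0 ≤ b ≤ 1`, `|b x|_λ² = b² |x_λ|² = 1` would force `b = 1` and `|x_λ| = 1`. [folklore] -/
theorem starConvex_beltPiece_image :
    StarConvex ℝ (0 : EuclideanSpace ℝ (Fin 5))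
      {x : EuclideanSpace ℝ (Fin 5) | ‖x‖ ≤ 1 ∧ lamSq 2 x ≠ 1} := by
  rintro x ⟨hx1, hxS⟩ a b ha hb hab
  rw [smul_zero, zero_add]
  refine ⟨?_, ?_⟩
  · rw [norm_smul, Real.norm_eq_abs, abs_of_nonneg hb]
    calc b * ‖x‖ ≤ 1 * 1 := by gcongr; linarith
      _ = 1 := one_mul 1
  · rw [lamSq_smul]
    intro h
    have hl : lamSq 2 x ≤ 1 := lamSq_le_one hx1
    have hb1 : b ≤ 1 := by linarith
    have hb2 : b ^ 2 ≤ 1 := by nlinarith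
    have hl0 := lamSq_nonneg 2 x
    -- `b² l = 1` with `b² ≤ 1`, `l ≤ 1` forces `l = 1`
    have : lamSq 2 x = 1 := by
      by_contra hne
      have hlt : lamSq 2 x < 1 := lt_of_le_of_ne hl hne
      nlinarith
    exact hxS this

/-- **The handle piece `D⁵ ∖ S` is simply connected** (star-shaped, hence contractible).
[cite: HatcherAT2002, Ch. 0 (p. 4)] -/
theorem simplyConnectedSpace_beltPiece : SimplyConnectedSpace ↥(beltPiece 4 2) := by
  -- the handle piece is homeomorphic to its image in `ℝ⁵`
  set B : Set (EuclideanSpace ℝ (Fin 5)) := {x | ‖x‖ ≤ 1 ∧ lamSq 2 x ≠ 1} with hB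
  have hemb : Topology.IsEmbedding (fun b : ↥(beltPiece 4 2) => (b.1.1 : EuclideanSpace ℝ (Fin 5))) :=
    Topology.IsEmbedding.subtypeVal.comp Topology.IsEmbedding.subtypeVal
  have hrange : range (fun b : ↥(beltPiece 4 2) => (b.1.1 : EuclideanSpace ℝ (Fin 5))) = B := by
    ext x
    constructor
    · rintro ⟨b, rfl⟩
      exact ⟨mem_closedBall_zero_iff.1 b.1.2, b.2⟩
    · rintro ⟨hx1, hxS⟩
      exact ⟨⟨⟨x, mem_closedBall_zero_iff.2 hx1⟩, hxS⟩, rfl⟩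
  haveI : ContractibleSpace ↥B :=
    starConvex_beltPiece_image.contractibleSpace ⟨0, by simp [lamSq]⟩
  let e : ↥(beltPiece 4 2) ≃ₜ ↥B := hemb.toHomeomorph.trans (Homeomorph.setCongr hrange)
  exact e.toHomotopyEquiv.simplyConnectedSpace_iff.2 inferInstance

/-- The handle piece, as a subset of itself, is simply connected. [folklore] -/
theorem isSimplyConnected_beltPiece_univ : IsSimplyConnected (univ : Set ↥(beltPiece 4 2)) := by
  haveI := simplyConnectedSpace_beltPiece
  exact (Homeomorph.Set.univ ↥(beltPiece 4 2)).toHomotopyEquiv.simplyConnectedSpace_iff.2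
    inferInstance

end Tube

end Literature.Topology.FourManifolds

end
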